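import Summits.BirchSwinnertonDyer.Rank1Residual.Additive.TwistedBranchPAdicGrossZagierEndState
import Summits.BirchSwinnertonDyer.Rank1Residual.Additive.UniversalNormTwistTransportRat
import Summits.BirchSwinnertonDyer.Rank1Residual.Additive.GordCycLowerBoundIntrinsic
import Summits.BirchSwinnertonDyer.Rank1Residual.Additive.LeadingTermClausesOfIntrinsic
import Summits.BirchSwinnertonDyer.Rank1Residual.Additive.SemistableTwistAnalytic
import Literature.NumberTheory.EllipticCurves.Rank1Residual.AnomalousDictionaryProofs
import HarnessLib

/-!
# Row B6 (O7-ord), defect 2, RANK ONE, ANOMALOUS OR NOT: the rank-one end states of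
# `TwistedBranchPAdicGrossZagierEndState.lean` with the non-anomalous hypothesis REPLACED by the twist
# transport of Mazur's universal norms (T-ANOM route R1, item (T4); cell `bsd-addord`, seat
# `bsd-addord-twist`, strategy = twist transport)

HONEST FRAMING (cell `bsd-addord`, `run/shared/lean/pub/bsd-addord/README.md` §4): the programme's
target of record is the full Birch–Swinnerton-Dyer formula for every `E/ℚ` of analytic rank `≤ 1`.
Theorems only: no definition, no named fact minted, no `sorry`, nothing booked. The sibling end states
(seat `bsd-addord-gz`, `ClassX3Gord.bsdp_rankOne_of_facts_of_delbourgoDatumFact_of_branchCoeffOneNeZero{,Odd}`)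
take `hna : ReductionNonAnomalous W p`, used ONLY to set Delbourgo's factor `ℓ_p(E) = 1` in Thm. (B)
(`Delbourgo2002.LeadingTermClauses`, clause 3). Here the SAME chain runs against Thm. (B) read with the
`ℓ`-invariant INTRINSIC (`Delbourgo2002.LeadingTermClausesIntrinsic`, p404293; referee (α′),
`REF-tanom.md`: the factor `[E(ℚ_p) : N_∞E(ℚ_p)]/c_p`, the paper's disputed evaluation `= 1 or p²`
(p. 70) NOT used), and the factor is shown to be a `p`-adic UNIT in the kernel:
`p ∤ [E(ℚ_p) : N_∞E(ℚ_p)]` by the twist transport (T3)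
(`UniversalNormTwist.not_dvd_localUniversalNormIndex_of_goodOrd_twist`, from Mazur 1972 Cor. 5.15 BY
NAME, `hMaz : Mazur1972.cor515_universalNormIndex`) and `c_p ≤ 4 < p`
(`tamagawaNumberAt_ne_zero_and_le_four_of_addv`). So the 177 anomalous rank-`1` keys of the cell's
census (TARGET.md S41 (2)) get end states of the same shape as the 80 non-anomalous ones.

THE ONE DISPLAYED NON-PUBLISHED INPUT is the datum hypothesis
`hDatum : ∃ Dh, LeadingTermClausesIntrinsic W p Dh ∧ TwistedBranchGrossZagierAt W p Dh` — the
`(B♮)`-currency form of the sibling's `hFact : Disegni2017.delbourgoDatum_rankOne_leadingTerms` (whose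
Gross–Zagier half is the CELL THEOREM PROOF-gz Thm. 1, referee condition GZ-H; seat `bsd-addord-gz`
owns its restatement as a named fact). It is a HYPOTHESIS of the theorems below, not a fact of the tree.

## What

* `ClassX3Gord.not_dvd_localUniversalNormIndex_of_facts` — on X3♯(G-ord) ∩ `I₀*` (`e = 2`, `p` odd):
  `[E(ℚ_p) : N_∞E(ℚ_p)] ≠ 0 → p ∤ [E(ℚ_p) : N_∞E(ℚ_p)]` from `hMaz` (the good ordinary twist model
  `C • V^{(p*)} = W` of `ClassX3Gord.exists_goodOrd_pStar_twist_model` fed to (T3)).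
* `ClassX4Gord.not_dvd_localUniversalNormIndex_of_facts` — the same on X4♯(G-ord) ∩ `I₀*`.
* `ClassX3Gord.bsdp_rankOne_of_facts_of_delbourgoDatumIntrinsic_of_branchCoeffOneNeZero` (`p ≡ 1 (4)`)
  and `…Odd` (`p ≡ 3 (4)`, `p ≥ 7`): `BSD(E,p)` on X3♯(G-ord) ∩ `I₀*`, `r_an = 1`, non-CM, branch-parity
  line position, from the PUBLISHED facts of the sibling + `hMaz` + `hDatum` + `BranchCoeffOneNeZeroAt W p`
  — NO `hna`. Chain = the sibling's, with (i) `hB : LeadingTermClauses W p Dh` DERIVED from the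
  intrinsic clauses (`leadingTermClauses_of_intrinsic_of_not_dvd`, `ℓ = 1`) for the upper half and
  Schneider, (ii) the lower half by `missingLowerBoundAt_of_cycLowerBound_of_not_dvd_index`.
* `ClassX4Gord.bsdp_rankOne_of_BSTW921c_OPEN_of_delbourgoDatumIntrinsic_of_katoHalf` — the sibling's
  "O7 twin" on X4♯(G-ord) ∩ `I₀*` ∩ Surj ∩ Ram (`p ≡ 1 (4)`; BSTW twist clause `hΛ` DISPLAYED, PRE) with
  `hna` removed the same way.

References: [Delbourgo2002] Thm. (A), (B) p. 40, p. 67 (iv), p. 69; [Mazur1972Towers] Cor. 5.15;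
[Disegni2017] Thm. B, Rem. 1.3.2; [GreenbergVatsal2000] §2 (11), (16), §3 Thm. (3.12);
[GreenbergLNM1716] Props. 2.2, 2.4, 4.14; [Wuthrich2014] Thm. 16; [Pal2012] Thm. 3.2; [Miller2011LMS]
Def. 1.1; cell files REF-tanom.md, PROOF-gz.md.
-/

noncomputable section

open scoped Classical MatrixGroups ModularForm NumberField

open CongruenceSubgroup WeierstrassCurve NumberField IsDedekindDomain Field
  Literature.NumberTheory.EllipticCurves Literature.NumberTheory.EllipticCurves.ModularForms
  Literature.NumberTheory.EllipticCurves.GreenbergVatsal2000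
  Literature.NumberTheory.EllipticCurves.Rank1Residual
  Literature.NumberTheory.EllipticCurves.Rank1Residual.Typed
  Literature.NumberTheory.EllipticCurves.Delbourgo2002
  Literature.NumberTheory.EllipticCurves.Disegni2017
  Literature.NumberTheory.GaloisRepresentations
  Summit.BirchSwinnertonDyer.Rank1Residual.AdditivePotMult
  Summit.BirchSwinnertonDyer.Rank1Residual.Additive.X3Branch

namespace Summit.BirchSwinnertonDyer.Rank1Residual.Additive

variable {W : WeierstrassCurve ℚ} [W.IsElliptic] [W.IsGloballyMinimal] {p : ℕ} [hp : Fact p.Prime]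

/-! ### §0 The two unit factors on the (G-ord, `e = 2`) rows -/

/-- **`p ∤ [E(ℚ_p) : N_∞E(ℚ_p)]` on X3♯(G-ord) ∩ `I₀*`** (odd `p`, any cyclotomic `κ`, `v ∣ p`),
GRANTED Mazur 1972 Cor. 5.15 (`hMaz`): the twist transport (T3) at the good ordinary twist model
`C • V^{(p*)} = W`. [cite: Mazur1972Towers, Cor. 5.15 with Remark (p. 229)] [cite: Delbourgo2002, p. 67 (iv), p. 69] -/
theorem ClassX3Gord.not_dvd_localUniversalNormIndex_of_facts
    (hMaz : Mazur1972.cor515_universalNormIndex) (hX : ClassX3Gord W p) (hp2 : p ≠ 2)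
    (he : semistabilityIndex W p = 2) (κ : ZpExtension ℚ p) (hκ : κ.IsCyclotomic)
    (v : HeightOneSpectrum (𝓞 ℚ)) (hv : (p : 𝓞 ℚ) ∈ v.asIdeal)
    (h0 : localUniversalNormIndex (W := W) (v.adicCompletion ℚ) κ ⊤ ≠ 0) :
    ¬ p ∣ localUniversalNormIndex (W := W) (v.adicCompletion ℚ) κ ⊤ := by
  obtain ⟨V, iV, iVm, C, hV, hC⟩ := hX.exists_goodOrd_pStar_twist_model W p hp2 he
  exact UniversalNormTwist.not_dvd_localUniversalNormIndex_of_goodOrd_twist V W κ v hMaz hp2 hV.1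
    (by exact_mod_cast hV.2) hκ hv hC h0

/-- **`p ∤ [E(ℚ_p) : N_∞E(ℚ_p)]` on X4♯(G-ord) ∩ `I₀*`** (any cyclotomic `κ`, `v ∣ p`), GRANTED
Mazur 1972 Cor. 5.15 (`hMaz`). [cite: Mazur1972Towers, Cor. 5.15 with Remark (p. 229)] [cite: Delbourgo2002, p. 67 (iv), p. 69] -/
theorem ClassX4Gord.not_dvd_localUniversalNormIndex_of_facts
    (hMaz : Mazur1972.cor515_universalNormIndex) (hX : ClassX4Gord W p)
    (he : semistabilityIndex W p = 2) (κ : ZpExtension ℚ p) (hκ : κ.IsCyclotomic)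
    (v : HeightOneSpectrum (𝓞 ℚ)) (hv : (p : 𝓞 ℚ) ∈ v.asIdeal)
    (h0 : localUniversalNormIndex (W := W) (v.adicCompletion ℚ) κ ⊤ ≠ 0) :
    ¬ p ∣ localUniversalNormIndex (W := W) (v.adicCompletion ℚ) κ ⊤ := by
  obtain ⟨V, iV, iVm, C, hV, hC⟩ := hX.exists_goodOrd_pStar_twist_model W p he
  exact UniversalNormTwist.not_dvd_localUniversalNormIndex_of_goodOrd_twist V W κ v hMaz hX.addv.1 hV.1
    (by exact_mod_cast hV.2) hκ hv hC h0

/-! ### §1 X3♯(G-ord) ∩ `I₀*`, rank one, anomalous OR NOT -/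

/-- **X3♯(G-ord) ∩ `I₀*` (defect `2`), `p ≡ 1 (mod 4)`, `E` non-CM, `r_an(E) = 1`, branch-parity line
position, ANOMALOUS OR NOT: `BSD(E,p)` from PUBLISHED named facts + Mazur 1972 Cor. 5.15 (`hMaz`) + the
`(B♮)`-currency datum `hDatum` + ONE analytic number `BranchCoeffOneNeZeroAt W p`.** The sibling
`ClassX3Gord.bsdp_rankOne_of_facts_of_delbourgoDatumFact_of_branchCoeffOneNeZero` with `hna` removed:
(L) `X3Branch.chiBranchLowerDivisibilityAt_of_facts`; (GZ) `branchPAdicGrossZagierAt_of_twisted`; (S)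
the sibling's §0; `hB := leadingTermClauses_of_intrinsic_of_not_dvd` (factor `[E(ℚ_p):N_∞]/c_p` a unit
by (T3) and `c_p ≤ 4`); lower half `missingLowerBoundAt_of_cycLowerBound_of_not_dvd_index`; upper half
`ClassX3Gord.missingUpperBoundAt_rankOne_of_wuthrichHalf_of_schneider_of_branchPAdicGrossZagier`.
Nothing booked. [cite: Delbourgo2002, Theorem (A), (B) (p. 40), p. 67 (iv), p. 69]
[cite: Mazur1972Towers, Cor. 5.15] [cite: GreenbergVatsal2000, §2 (11), (16), §3 Thm. (3.12) p. 45]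
[cite: Wuthrich2014, Thm. 16 (p. 397)] [cite: GreenbergLNM1716, Props. 2.2, 2.4, 4.14] [cite: Pal2012, Thm. 3.2]
[cite: Miller2011LMS, Def. 1.1] -/
theorem ClassX3Gord.bsdp_rankOne_of_facts_of_delbourgoDatumIntrinsic_of_branchCoeffOneNeZero
    (hW16 : Wuthrich2014.thm16_halfEigenCharIdeal_dvd_cyclotomicPrime)
    (hGV : thm312_branch_unitContent_and_lambda_eq_residual_goodOrd)
    (h23 : datumSelmer_nonPrimitive_invariants)
    (h414 : Greenberg1999.prop414_noFiniteSubmodule_of_not_dvd_torsionOrder)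
    (hGrK : Greenberg1999.imKummer_ge_strictCondition_goodOrdinary)
    (hLiftF : residualEpsilon_surjOn_of_lineRamifiedEven)
    (hMaz : Mazur1972.cor515_universalNormIndex) (hDel : Delbourgo2002.mainTheorem)
    (hmod : hasEntireLFunction_rat) (hmodD : nonempty_modularParametrizationData)
    (hGZK : rank_eq_analyticRank_of_analyticRank_le_one)
    (hX : ClassX3Gord W p) (he : semistabilityIndex W p = 2) (hp4 : p % 4 = 1) (hcm : ¬ W.HasCM)
    (hr : W.analyticRank = 1)
    (hDatum : ∃ Dh : PAdicHeightData W p,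
      LeadingTermClausesIntrinsic W p Dh ∧ TwistedBranchGrossZagierAt W p Dh)
    (Φ₀ : AddSubgroup (W.geomTorsion (p : ℤ))) (hΦ : IsRationalLine W p Φ₀)
    (hram0 : ¬ LineUnramifiedAt W p Φ₀) (heven : LineEven W p Φ₀)
    (hram : ∀ (K : Type) [Field K] [NumberField K] [(galRange (K := ℚ) K).Normal],
      Module.finrank ℚ K = 2 → (∃ θ : K, θ ^ 2 = algebraMap ℚ K ((-1) ^ (p / 2) * p)) →
      ¬ ∀ v : HeightOneSpectrum (𝓞 ℚ), ((p : ℕ) : 𝓞 ℚ) ∈ v.asIdeal →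
        ∀ 𝔓 ∈ v.primesAbove, ∀ σ ∈ 𝔓.inertia (absoluteGaloisGroup ℚ), ∀ P ∈ Φ₀,
          σ • P = (if σ ∈ galRange (K := ℚ) K then P else -P))
    (hne : BranchCoeffOneNeZeroAt W p) : BSDp W p := by
  have hp2 : p ≠ 2 := by omega
  have hp5 : 5 ≤ p := by have := hp.out.two_le; omega
  have hev : Even (p / 2) := ⟨p / 4, by omega⟩
  -- (L) from published facts + the line data
  obtain ⟨S₀, hS₀, hS⟩ := X2.GreenbergVatsalCaseOne.exists_finset_bad_not_mem W p
  have hdiv : ChiBranchLowerDivisibilityAt W p :=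
    X3Branch.chiBranchLowerDivisibilityAt_of_facts hW16 hGV h23 h414 hGrK hLiftF S₀ hS₀ hS Φ₀ hΦ hram0
      heven hram
  -- the datum: (B♮) + (GZ); the two unit factors at the place over `p`; (B) in the `ℓ`-currency
  obtain ⟨Dh, hBι, hTw⟩ := hDatum
  set v₀ : HeightOneSpectrum (𝓞 ℚ) := (Rat.HeightOneSpectrum.primesEquiv (R := 𝓞 ℚ)).symm ⟨p, hp.out⟩ with hv₀_def
  have hv₀ : (p : 𝓞 ℚ) ∈ v₀.asIdeal := natCast_mem_asIdeal_of_primesEquiv_eq (primesEquiv_symm_apply_coe p)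
  have hcp : ¬ p ∣ W.tamagawaNumberAt v₀ :=
    TypeGOrd.not_dvd_tamagawaNumberAt_of_semistabilityIndex_eq_two W p hp2 hX.typeGOrd hX.addv he
  have hcp0 : W.tamagawaNumberAt v₀ ≠ 0 := (tamagawaNumberAt_ne_zero_and_le_four_of_addv W p hX.addv).1
  have hι : ∀ κ : ZpExtension ℚ p, κ.IsCyclotomic →
      localUniversalNormIndex (W := W) (v₀.adicCompletion ℚ) κ ⊤ ≠ 0 →
      ¬ p ∣ localUniversalNormIndex (W := W) (v₀.adicCompletion ℚ) κ ⊤ :=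
    fun κ hκ h0 ↦ hX.not_dvd_localUniversalNormIndex_of_facts hMaz hp2 he κ hκ v₀ hv₀ h0
  have hB : LeadingTermClauses W p Dh := leadingTermClauses_of_intrinsic_of_not_dvd hBι v₀ hv₀ hcp hι
  have hGZ : BranchPAdicGrossZagierAt W p Dh := branchPAdicGrossZagierAt_of_twisted hGZK hr hTw
  -- the twist model and (S)
  obtain ⟨V, iV, iVm, C, hV, hC⟩ := hX.exists_goodOrd_pStar_twist_model W p hp2 he
  have hSch : SchneiderConjecture Dh :=
    schneiderConjecture_of_twisted_of_branchCoeffOneNeZero hp2 hmodD hr hTw hne V C hC hV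
  -- lower half at the datum, intrinsic currency
  haveI : NeZero (V.conductorNorm ℤ) := ⟨(V.conductorNorm_pos_holds).ne'⟩
  obtain ⟨Dm⟩ := hmodD V
  obtain ⟨ϖ, -, hϖ, -⟩ := Dm.exists_rat_mul_realPeriodRat_eq_plusPeriod
  have hps : ((-1 : ℚ) ^ (p / 2) * (p : ℚ)) = (p : ℚ) := by rw [hev.neg_one_pow, one_mul]
  have hVW : ∃ C : VariableChange ℚ, C • V.quadraticTwist (p : ℚ) = W := ⟨C, by rw [← hps]; exact hC⟩
  have hlow : CycLowerBoundAt W p Dh :=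
    cycLowerBoundAt_of_chiBranchLower_of_branchPAdicGrossZagier W p
      Pal2012.thm32_sqrt_mul_realPeriodRat_twist_eq_of_prime_one_mod_four_holds hmod hGZK hX.addv hr hp4
      V hVW hV Dm.isNewformOf ϖ hϖ hdiv hGZ
  have hl : MissingLowerBoundAt W p :=
    missingLowerBoundAt_of_cycLowerBound_of_not_dvd_index W p hBι hSch
      (fun κ γ hκ hγ D ↦ hDel.isTorsion hp5 hcm hX.addv hX.typeGOrd hκ hγ D) hGZK (by rw [hr]) v₀ hv₀
      hcp0 hι hlow
  -- upper half at the datum (ℓ-currency clauses derived above), and the glue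
  have hu : MissingUpperBoundAt W p :=
    hX.missingUpperBoundAt_rankOne_of_wuthrichHalf_of_schneider_of_branchPAdicGrossZagier hW16 hGZK hmod
      hmodD he hp4 hr hB hSch hGZ
  exact bsdp_of_missingPPartAt W p hGZK (by rw [hr]) (missingPPartAt_of_lower_of_upper W p hl hu)

/-- **X3♯(G-ord) ∩ `I₀*`, `p ≡ 3 (mod 4)`, `p ≥ 7`, `E` non-CM, `r_an(E) = 1`, branch-parity line
position, ANOMALOUS OR NOT: `BSD(E,p)` from PUBLISHED named facts + `hMaz` + `hDatum` +
`BranchCoeffOneNeZeroAt W p`** — the odd-branch twin (the sibling's `…Odd` with `hna` removed).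
Nothing booked. [cite: Delbourgo2002, Theorem (A), (B) (p. 40), p. 67 (iv), p. 69] [cite: Mazur1972Towers, Cor. 5.15]
[cite: GreenbergVatsal2000, §2 (11), (16), §3 Thm. (3.12) p. 45] [cite: Wuthrich2014, Thm. 16 (p. 397)]
[cite: GreenbergLNM1716, Props. 2.2, 2.4, 4.14] [cite: Miller2011LMS, Def. 1.1] -/
theorem ClassX3Gord.bsdp_rankOne_of_facts_of_delbourgoDatumIntrinsic_of_branchCoeffOneNeZeroOdd
    (hW16 : Wuthrich2014.thm16_halfEigenCharIdeal_dvd_cyclotomicPrime)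
    (hGV : thm312_branch_unitContent_and_lambda_eq_residual_goodOrd)
    (h23 : datumSelmer_nonPrimitive_invariants)
    (h414 : Greenberg1999.prop414_noFiniteSubmodule_of_not_dvd_torsionOrder)
    (hGrK : Greenberg1999.imKummer_ge_strictCondition_goodOrdinary)
    (hLiftF : residualEpsilon_surjOn_of_lineRamifiedEven)
    (hMaz : Mazur1972.cor515_universalNormIndex) (hDel : Delbourgo2002.mainTheorem)
    (hmod : hasEntireLFunction_rat) (hmodD : nonempty_modularParametrizationData)
    (hGZK : rank_eq_analyticRank_of_analyticRank_le_one)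
    (hX : ClassX3Gord W p) (he : semistabilityIndex W p = 2) (hp4 : p % 4 = 3) (hp5 : 5 ≤ p)
    (hcm : ¬ W.HasCM) (hr : W.analyticRank = 1)
    (hDatum : ∃ Dh : PAdicHeightData W p,
      LeadingTermClausesIntrinsic W p Dh ∧ TwistedBranchGrossZagierAt W p Dh)
    (Φ₀ : AddSubgroup (W.geomTorsion (p : ℤ))) (hΦ : IsRationalLine W p Φ₀)
    (hram0 : ¬ LineUnramifiedAt W p Φ₀) (heven : LineEven W p Φ₀)
    (hram : ∀ (K : Type) [Field K] [NumberField K] [(galRange (K := ℚ) K).Normal],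
      Module.finrank ℚ K = 2 → (∃ θ : K, θ ^ 2 = algebraMap ℚ K ((-1) ^ (p / 2) * p)) →
      ¬ ∀ v : HeightOneSpectrum (𝓞 ℚ), ((p : ℕ) : 𝓞 ℚ) ∈ v.asIdeal →
        ∀ 𝔓 ∈ v.primesAbove, ∀ σ ∈ 𝔓.inertia (absoluteGaloisGroup ℚ), ∀ P ∈ Φ₀,
          σ • P = (if σ ∈ galRange (K := ℚ) K then P else -P))
    (hne : BranchCoeffOneNeZeroAt W p) : BSDp W p := by
  have hp2 : p ≠ 2 := by omega
  -- (L) from published facts + the line data, odd branch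
  obtain ⟨S₀, hS₀, hS⟩ := X2.GreenbergVatsalCaseOne.exists_finset_bad_not_mem W p
  have hdiv : ChiBranchLowerDivisibilityOddAt W p :=
    X3Branch.chiBranchLowerDivisibilityOddAt_of_facts hW16 hGV h23 h414 hGrK hLiftF S₀ hS₀ hS Φ₀ hΦ
      hram0 heven hram
  -- the datum: (B♮) + (GZ); the two unit factors; (B) in the `ℓ`-currency
  obtain ⟨Dh, hBι, hTw⟩ := hDatum
  set v₀ : HeightOneSpectrum (𝓞 ℚ) := (Rat.HeightOneSpectrum.primesEquiv (R := 𝓞 ℚ)).symm ⟨p, hp.out⟩ with hv₀_def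
  have hv₀ : (p : 𝓞 ℚ) ∈ v₀.asIdeal := natCast_mem_asIdeal_of_primesEquiv_eq (primesEquiv_symm_apply_coe p)
  have hcp : ¬ p ∣ W.tamagawaNumberAt v₀ :=
    TypeGOrd.not_dvd_tamagawaNumberAt_of_semistabilityIndex_eq_two W p hp2 hX.typeGOrd hX.addv he
  have hcp0 : W.tamagawaNumberAt v₀ ≠ 0 := (tamagawaNumberAt_ne_zero_and_le_four_of_addv W p hX.addv).1
  have hι : ∀ κ : ZpExtension ℚ p, κ.IsCyclotomic →
      localUniversalNormIndex (W := W) (v₀.adicCompletion ℚ) κ ⊤ ≠ 0 →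
      ¬ p ∣ localUniversalNormIndex (W := W) (v₀.adicCompletion ℚ) κ ⊤ :=
    fun κ hκ h0 ↦ hX.not_dvd_localUniversalNormIndex_of_facts hMaz hp2 he κ hκ v₀ hv₀ h0
  have hB : LeadingTermClauses W p Dh := leadingTermClauses_of_intrinsic_of_not_dvd hBι v₀ hv₀ hcp hι
  have hGZ : BranchPAdicGrossZagierOddAt W p Dh := branchPAdicGrossZagierOddAt_of_twisted hGZK hr hTw
  -- the twist model and (S)
  obtain ⟨V, iV, iVm, C, hV, hC⟩ := hX.exists_goodOrd_pStar_twist_model W p hp2 he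
  have hSch : SchneiderConjecture Dh :=
    schneiderConjecture_of_twisted_of_branchCoeffOneNeZero hp2 hmodD hr hTw hne V C hC hV
  -- lower half at the datum, intrinsic currency
  haveI : NeZero (V.conductorNorm ℤ) := ⟨(V.conductorNorm_pos_holds).ne'⟩
  obtain ⟨Dm⟩ := hmodD V
  obtain ⟨ϖ, -, hϖ⟩ := exists_rat_mul_imaginaryPeriodRat_eq_minusPeriod Dm
  have hps : ((-1 : ℚ) ^ (p / 2) * (p : ℚ)) = -(p : ℚ) := by
    rw [pStar_eq_of_mod_four p (Or.inr hp4), if_neg (by omega)]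
  have hVW : ∃ C : VariableChange ℚ, C • V.quadraticTwist (-(p : ℚ)) = W :=
    ⟨C, by rw [← hps]; exact hC⟩
  have hlow : CycLowerBoundAt W p Dh :=
    cycLowerBoundAt_of_chiBranchLowerOdd_of_branchPAdicGrossZagierOdd W p hmod hGZK hX.addv hr hp4 V hVW
      hV Dm.isNewformOf ϖ hϖ hdiv hGZ
  have hl : MissingLowerBoundAt W p :=
    missingLowerBoundAt_of_cycLowerBound_of_not_dvd_index W p hBι hSch
      (fun κ γ hκ hγ D ↦ hDel.isTorsion hp5 hcm hX.addv hX.typeGOrd hκ hγ D) hGZK (by rw [hr]) v₀ hv₀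
      hcp0 hι hlow
  -- upper half at the datum, and the glue
  have hu : MissingUpperBoundAt W p :=
    hX.missingUpperBoundAt_rankOne_of_wuthrichHalf_of_branchPAdicGrossZagierOdd hW16 hGZK hmod hmodD he
      hp4 hr hB hSch hGZ
  exact bsdp_of_missingPPartAt W p hGZK (by rw [hr]) (missingPPartAt_of_lower_of_upper W p hl hu)

/-! ### §2 X4♯(G-ord) ∩ `I₀*`, rank one, `p ≡ 1 (mod 4)`: the "O7 twin", anomalous OR NOT -/

/-- **THE "O7 TWIN" WITHOUT `hna`.** X4♯(G-ord) ∩ `I₀*` (`e = 2`) ∩ {`ρ̄_{E,p}` onto} ∩ (ram),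
`p ≡ 1 (mod 4)`, `E` non-CM, `r_an(E) = 1`, ANOMALOUS OR NOT: `BSD(E,p)` GRANTED the OPEN/PRE
Burungale–Skinner–Tian–Wan twist clause read Λ-adically (`hΛ`, a displayed hypothesis — NOT a theorem),
Mazur 1972 Cor. 5.15 (`hMaz`), the `(B♮)`-currency datum `hDatum`, Kato's half (`hK`), Delbourgo (A)
(`hDel`), modularity, GZK, and `BranchCoeffOneNeZeroAt W p`. The sibling
`ClassX4Gord.bsdp_rankOne_of_BSTW921c_OPEN_of_delbourgoDatumFact_of_katoHalf` with `hna` removed exactly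
as in §1. Nothing booked. [claim: BurungaleSkinnerTianWan2024, status: under-review]
[cite: Delbourgo2002, Theorem (A), (B) (p. 40), p. 67 (iv), p. 69] [cite: Mazur1972Towers, Cor. 5.15]
[cite: Kato2004Asterisque, Thm. 17.4 (3) (p. 273)] [cite: Pal2012, Thm. 3.2] [cite: Miller2011LMS, Def. 1.1] -/
theorem ClassX4Gord.bsdp_rankOne_of_BSTW921c_OPEN_of_delbourgoDatumIntrinsic_of_katoHalf
    (hΛ : BurungaleSkinnerTianWan2024_thm921c_twist_chiBranchLowerDivisibility_OPEN)
    (hMaz : Mazur1972.cor515_universalNormIndex) (hDel : Delbourgo2002.mainTheorem)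
    (hK : Wuthrich2014.kato_halfEigenCharIdeal_dvd_cyclotomicPrime_of_surjective)
    (hmod : hasEntireLFunction_rat) (hmodD : nonempty_modularParametrizationData)
    (hGZK : rank_eq_analyticRank_of_analyticRank_le_one) (hX : ClassX4Gord W p)
    (he : semistabilityIndex W p = 2) (hp4 : p % 4 = 1) (hcm : ¬ W.HasCM)
    (hsurj : Surj W p) (hram : Ram W p) (hr : W.analyticRank = 1)
    (hDatum : ∃ Dh : PAdicHeightData W p,
      LeadingTermClausesIntrinsic W p Dh ∧ TwistedBranchGrossZagierAt W p Dh)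
    (hne : BranchCoeffOneNeZeroAt W p) : BSDp W p := by
  have hp2 : p ≠ 2 := by omega
  have hp5 : 5 ≤ p := by have := hp.out.two_le; omega
  have hev : Even (p / 2) := ⟨p / 4, by omega⟩
  -- (L) on BSTW's slice
  have hdiv : ChiBranchLowerDivisibilityAt W p :=
    hΛ W p hp5 hp4 ⟨hp2, hX.addv.2, hX.typeGOrd, he⟩ hX.1.2.2 hram
  -- the datum: (B♮) + (GZ); the two unit factors; (B) in the `ℓ`-currency
  obtain ⟨Dh, hBι, hTw⟩ := hDatum
  set v₀ : HeightOneSpectrum (𝓞 ℚ) := (Rat.HeightOneSpectrum.primesEquiv (R := 𝓞 ℚ)).symm ⟨p, hp.out⟩ with hv₀_def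
  have hv₀ : (p : 𝓞 ℚ) ∈ v₀.asIdeal := natCast_mem_asIdeal_of_primesEquiv_eq (primesEquiv_symm_apply_coe p)
  have hcp : ¬ p ∣ W.tamagawaNumberAt v₀ :=
    TypeGOrd.not_dvd_tamagawaNumberAt_of_semistabilityIndex_eq_two W p hp2 hX.typeGOrd hX.addv.2 he
  have hcp0 : W.tamagawaNumberAt v₀ ≠ 0 :=
    (tamagawaNumberAt_ne_zero_and_le_four_of_addv W p hX.addv.2).1
  have hι : ∀ κ : ZpExtension ℚ p, κ.IsCyclotomic →
      localUniversalNormIndex (W := W) (v₀.adicCompletion ℚ) κ ⊤ ≠ 0 →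
      ¬ p ∣ localUniversalNormIndex (W := W) (v₀.adicCompletion ℚ) κ ⊤ :=
    fun κ hκ h0 ↦ hX.not_dvd_localUniversalNormIndex_of_facts hMaz he κ hκ v₀ hv₀ h0
  have hB : LeadingTermClauses W p Dh := leadingTermClauses_of_intrinsic_of_not_dvd hBι v₀ hv₀ hcp hι
  have hGZ : BranchPAdicGrossZagierAt W p Dh := branchPAdicGrossZagierAt_of_twisted hGZK hr hTw
  -- the twist model and (S)
  obtain ⟨V, iV, iVm, C, hV, hC⟩ := hX.exists_goodOrd_pStar_twist_model W p he
  have hSch : SchneiderConjecture Dh :=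
    schneiderConjecture_of_twisted_of_branchCoeffOneNeZero hp2 hmodD hr hTw hne V C hC hV
  -- lower half at the datum, intrinsic currency
  haveI : NeZero (V.conductorNorm ℤ) := ⟨(V.conductorNorm_pos_holds).ne'⟩
  obtain ⟨Dm⟩ := hmodD V
  obtain ⟨ϖ, -, hϖ, -⟩ := Dm.exists_rat_mul_realPeriodRat_eq_plusPeriod
  have hps : ((-1 : ℚ) ^ (p / 2) * (p : ℚ)) = (p : ℚ) := by rw [hev.neg_one_pow, one_mul]
  have hVW : ∃ C : VariableChange ℚ, C • V.quadraticTwist (p : ℚ) = W := ⟨C, by rw [← hps]; exact hC⟩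
  have hlow : CycLowerBoundAt W p Dh :=
    cycLowerBoundAt_of_chiBranchLower_of_branchPAdicGrossZagier W p
      Pal2012.thm32_sqrt_mul_realPeriodRat_twist_eq_of_prime_one_mod_four_holds hmod hGZK hX.addv.2 hr
      hp4 V hVW hV Dm.isNewformOf ϖ hϖ hdiv hGZ
  have hl : MissingLowerBoundAt W p :=
    missingLowerBoundAt_of_cycLowerBound_of_not_dvd_index W p hBι hSch
      (fun κ γ hκ hγ D ↦ hDel.isTorsion hp5 hcm hX.addv.2 hX.typeGOrd hκ hγ D) hGZK (by rw [hr]) v₀ hv₀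
      hcp0 hι hlow
  -- upper half at the datum, and the glue
  have hu : MissingUpperBoundAt W p :=
    hX.missingUpperBoundAt_rankOne_of_katoHalf_of_schneider_of_branchPAdicGrossZagier hK hGZK hmod hmodD
      he hp4 hsurj hr hB hSch hGZ
  exact bsdp_of_missingPPartAt W p hGZK (by rw [hr]) (missingPPartAt_of_lower_of_upper W p hl hu)

end Summit.BirchSwinnertonDyer.Rank1Residual.Additive

end
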